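import Summits.QuantumFields.BalabanUV.T4Continuum.Support.BlockAveragePushDirSplit
import Summits.QuantumFields.BalabanUV.T4Continuum.Support.AveragingDeficitMultiLevelPrep
import Summits.QuantumFields.BalabanUV.T4Continuum.Support.AveragingDeficitPushForwardLinear
import Summits.QuantumFields.BalabanUV.T4Continuum.Support.AveragingDeficitLiftPeriodic
import HarnessLib

/-!
# T⁴ programme, node NE3 — THE COVARIANT STRUCTURE OF THE LINEARISED BLOCK AVERAGE AT A SMALL-FIELD BACKGROUND, ONE LEVEL:
# `cpush L W Y = Qbar L W Y + gaugeDir (cavg L W) (Fbar L W Y)` (frames = COARSE GAUGE DIRECTIONS), gauge directions are mapped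
# to gauge directions EXACTLY, and the coarse readings `Qbar`∕`Fbar` are skew, periodic and additive — the inputs of the tower file

NE3 formalisation swarm `b2b-balaban-t4-ne3-formalise-*`, LEAF PROVER 04 (gen 4), sub-row **E-MLw-w4-S** (INTENT in HOME/CLAIMS.log,
2026-08-20 ≈14:08Z) under the (w4) CORE «(P_W) at `W = cavg L U_B`» of `t4/formal/NE3/LEAVES.md` row E-MLw-w4 (owner
`t4-ne3-p1-g20`, «claimable by INTENT», CLAIMS.log l.14083).  File 1 of the covariant twin of this unit's file (A)
`NE3TangentFlatStructure` (p219035: at `W = 1`, `(Tcoarse L)^[k] Y = (Qcoarse L)^[k] Y − dPot (framePot L k Y)`), built on the tree's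
one-level covariant split and covariance BY NAME:
* (K2) `BlockAveragePushDirSplit.pushDir_eq_gaugeDir_add_dbarLin` — `pushDir L W Y (L•y) κ = gaugeDir (cavg L W) (frameLin L W Y ∘ L•) y κ
  + dbarLin L W Y (L•y) κ` (the linearised average = the coarse gauge direction generated by the linearised FRAMES + the linearised
  DOUBLE-BAR average, B7 (89)∕(120) TYPE; an identity);
* (K1) `BlockAveragePushDirGauge.pushDir_gaugeDir_eq_gaugeDir_cavg` — `pushDir L W (gaugeDir W λ) (L•q) κ = gaugeDir (cavg L W) (λ ∘ L•) q κ`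
  (the linearisation of the exact covariance (45) of the average; unitary periodic small-field `W`, torus representatives `q`).

CONTENT (all [folklore]; 0 sorry; DATA defs `Qbar`, `Fbar` (coarse readings of the tree's `dbarLin`∕`frameLin`) → async audit;
no `def … : Prop`):
§1 `cpush_eq_Qbar_add_gaugeDir` (K2 read on the coarse lattice), `gaugeDir_add_fun`; the `1/32`-ball of the loop variables in the
   small-field class (`norm_Wcx_sub_one_le_32`, from `B7Prop2Explicit.norm_Wcx_sub_one_le`), `cpush_add`, `frameLin_add`, `Qbar_add`,
   `Fbar_add`;
§2 **`cpush_gaugeDir`** — K1 at EVERY coarse site (the tree's statement at the representatives, extended by `M`-periodicity of both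
   sides: `AveragingDeficitMultiLevelPrep.isPeriodicDir_cpush`, `BlockAveragePushDirGauge.isPeriodicDir_gaugeDir`,
   `AveragingDeficitTorusChart.eq_wrap_add`∕`periodic_smul_vec`);
§3 skewness and periodicity of the coarse readings: `frameLin_mem_skewAdjoint`, `Fbar_skew`, `Qbar_skew` (via the tree's
   `pushDir_mem_skewAdjoint`, `dhol_mem_skewAdjoint`, `bavg_mem_unitaryUnits`), `frameLin_add_period` (via `dhol_shift`),
   `Fbar_add_period`, `Qbar_add_period`.

WHY (honest).  With these, the tower file proves `Y_k = Q̄^{(k)} Y + gaugeDir W_k (G_k)` EXACTLY (no O(a) error: the covariance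
of (42) is exact), reducing the open (w4) core to a statement about directions whose covariant straight k-fold average is a coarse
gauge direction — as (A) did at `W = 1`.  Nothing about Bałaban's minimisers, (P_W), (ML_w), T-E_w or NE3 is asserted; NE3 NOT
proved; spine 0∕9; finite T⁴ rung (B)+1 — NOT infinite volume, NOT mass gap, NOT BetaPertH, NOT Clay.  ABSOLUTE RULE kept (context:
[Balaban1985Averaging] (45) p. 24, (89)∕(110)–(125) pp. 31–36).  PLACEMENT: `Summits/QuantumFields/BalabanUV/`.
-/

set_option autoImplicit false

open scoped BigOperators Matrix.Norms.L2Operator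
open Finset

namespace Summit.QuantumFields.BalabanUV.T4Continuum.NE3TangentCovariantStructure

open Literature.MathematicalPhysics.QuantumFieldTheory.Balaban1983to89
open B7Prop1Explicit B7Prop2Explicit
open T4AveragingDeficitWall (IsUnitaryCfg IsSkewDir SmallField Ad)
open T4AveragingDeficitWallBoundary (IsPeriodicCfg)
open AveragingDeficitPeriodicCounting (IsPeriodicDir)
open AveragingDeficitResidualPairing (pushDir pushDir_mem_skewAdjoint)
open AveragingDeficitChartCalculus (cavg)
open AveragingDeficitMultiLevelPrep (cpush isPeriodicDir_cpush)
open AveragingDeficitFermat (isPeriodicCfg_cavg)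
open AveragingDeficitTorusChart (eq_wrap_add periodic_smul_vec redN)
open AveragingDeficitPushForwardLinear (pushDir_add pushDir_smul)
open AveragingDeficitTransport (dhol dhol_mem_skewAdjoint Ad_mem_skewAdjoint mem_U1_of_unitary)
open AveragingDeficitTransportCalc (dhol_add)
open AveragingDeficitLiftPeriodic (shiftDir dhol_shift pushDir_shift bavg_shift)
open BlockAveragePushDirGauge (gaugeDir isPeriodicDir_gaugeDir pushDir_gaugeDir_eq_gaugeDir_cavg)
open BlockAveragePushDirSplit (frameLin dbarLin pushDir_eq_gaugeDir_add_dbarLin)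

noncomputable section

variable {d : ℕ} {n : Type*} [Fintype n] [DecidableEq n]

local notation "𝕄" => Matrix n n ℂ

/-! ## §1 The coarse readings, the one-level split, additivity -/

/-- THE LINEARISED DOUBLE-BAR AVERAGE READ ON THE COARSE UNIT LATTICE: `Qbar L W Y (z, κ) := dbarLin L W Y (L•z, κ)`
(`= Qcoarse L Y` at `W = 1`, `BlockAveragePushDirSplit.dbarLin_flat`). [cite: Balaban1985Averaging, (120) p.35] -/
def Qbar (L : ℕ) (W : Site d → Fin d → 𝕄ˣ) (Y : Site d → Fin d → 𝕄) : Site d → Fin d → 𝕄 :=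
  fun z κ => dbarLin L W Y ((L : ℤ) • z) κ

/-- THE LINEARISED FRAME READ ON THE COARSE UNIT LATTICE: `Fbar L W Y z := frameLin L W Y (L•z)`.
[cite: Balaban1985Averaging, (112) p.34] -/
def Fbar (L : ℕ) (W : Site d → Fin d → 𝕄ˣ) (Y : Site d → Fin d → 𝕄) : Site d → 𝕄 :=
  fun z => frameLin L W Y ((L : ℤ) • z)

/-- **ONE LEVEL (K2 on the coarse lattice)**: `cpush L W Y z κ = Qbar L W Y z κ + gaugeDir (cavg L W) (Fbar L W Y) z κ`. [folklore] -/
theorem cpush_eq_Qbar_add_gaugeDir (L : ℕ) (W : Site d → Fin d → 𝕄ˣ) (Y : Site d → Fin d → 𝕄) (z : Site d) (κ : Fin d) :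
    cpush L W Y z κ = Qbar L W Y z κ + gaugeDir (cavg L W) (Fbar L W Y) z κ := by
  show pushDir L W Y ((L : ℤ) • z) κ = _
  rw [pushDir_eq_gaugeDir_add_dbarLin, add_comm]
  rfl

/-- `gaugeDir` is additive in the generator. [folklore] -/
theorem gaugeDir_add_fun (W : Site d → Fin d → 𝕄ˣ) (lam mu : Site d → 𝕄) (z : Site d) (κ : Fin d) :
    gaugeDir W (fun x => lam x + mu x) z κ = gaugeDir W lam z κ + gaugeDir W mu z κ := by
  simp only [gaugeDir, Ad, Matrix.mul_add, Matrix.add_mul]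
  abel

omit [Fintype n] [DecidableEq n] in
/-- Rescaling bookkeeping: `(L•) ∘ (L^j•) = (L^{j+1}•)` inside a generator. [folklore] -/
theorem comp_smul_smul (L : ℕ) (j : ℕ) (lam : Site d → 𝕄) :
    (fun y : Site d => (fun x : Site d => lam ((L : ℤ) • x)) (((L : ℤ) ^ j) • y)) = fun y => lam (((L : ℤ) ^ (j + 1)) • y) := by
  funext y
  simp only [smul_smul]
  congr 1
  rw [pow_succ, mul_comm]

/-- The loop variables of the average lie in the `1/32`-ball throughout the small-field class with `512(d+1)(d+4)L²a ≤ 1`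
(the tree's `B7Prop2Explicit.norm_Wcx_sub_one_le`: `≤ 2·8(d+1)(d+4)L²a`). [cite: Balaban1985Averaging, p.25] -/
theorem norm_Wcx_sub_one_le_32 [Nonempty n] {L : ℕ} (hL : 1 ≤ L) {W : Site d → Fin d → 𝕄ˣ} (hWu : IsUnitaryCfg W)
    {a : ℝ} (ha : 0 ≤ a) (hsmall : 512 * (d + 1) * (d + 4) * (L : ℝ) ^ 2 * a ≤ 1) (hWa : SmallField W a)
    (q : Site d) (κ : Fin d) (r : Fin d → Fin L) :
    ‖((Wcx L W q κ (boxVec L r) : 𝕄ˣ) : 𝕄) - 1‖ ≤ 1 / 32 := by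
  have h := norm_Wcx_sub_one_le L hL W (fun x κ' => mem_U1_of_unitary (hWu x κ')) ha hsmall hWa q κ r
  refine h.trans ?_
  nlinarith

/-- `cpush` is additive (in the ball of the small-field class). [folklore] -/
theorem cpush_add [Nonempty n] {L : ℕ} (hL : 1 ≤ L) {W : Site d → Fin d → 𝕄ˣ} (hWu : IsUnitaryCfg W)
    {a : ℝ} (ha : 0 ≤ a) (hsmall : 512 * (d + 1) * (d + 4) * (L : ℝ) ^ 2 * a ≤ 1) (hWa : SmallField W a)
    (A B : Site d → Fin d → 𝕄) :
    cpush L W (fun y μ => A y μ + B y μ) = fun z κ => cpush L W A z κ + cpush L W B z κ := by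
  funext z κ
  have hW := fun r => norm_Wcx_sub_one_le_32 hL hWu ha hsmall hWa ((L : ℤ) • z) κ r
  have hAB : (fun y μ => A y μ + B y μ) = A + B := rfl
  show pushDir L W (fun y μ => A y μ + B y μ) ((L : ℤ) • z) κ = pushDir L W A ((L : ℤ) • z) κ + pushDir L W B ((L : ℤ) • z) κ
  rw [hAB, pushDir_add L W A B _ κ hW]

/-- `frameLin` is additive. [folklore] -/
theorem frameLin_add (L : ℕ) (W : Site d → Fin d → 𝕄ˣ) (A B : Site d → Fin d → 𝕄) (y : Site d) :
    frameLin L W (fun x μ => A x μ + B x μ) y = frameLin L W A y + frameLin L W B y := by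
  unfold frameLin
  rw [← Finset.sum_add_distrib]
  refine Finset.sum_congr rfl fun r _ => ?_
  rw [← smul_add]
  congr 1
  have hAB : (fun x μ => A x μ + B x μ) = A + B := rfl
  rw [hAB, dhol_add]

/-- `Fbar` is additive. [folklore] -/
theorem Fbar_add (L : ℕ) (W : Site d → Fin d → 𝕄ˣ) (A B : Site d → Fin d → 𝕄) :
    Fbar L W (fun x μ => A x μ + B x μ) = fun z => Fbar L W A z + Fbar L W B z := by
  funext z
  exact frameLin_add L W A B _

/-- `Qbar` is additive (in the ball of the small-field class). [folklore] -/
theorem Qbar_add [Nonempty n] {L : ℕ} (hL : 1 ≤ L) {W : Site d → Fin d → 𝕄ˣ} (hWu : IsUnitaryCfg W)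
    {a : ℝ} (ha : 0 ≤ a) (hsmall : 512 * (d + 1) * (d + 4) * (L : ℝ) ^ 2 * a ≤ 1) (hWa : SmallField W a)
    (A B : Site d → Fin d → 𝕄) :
    Qbar L W (fun y μ => A y μ + B y μ) = fun z κ => Qbar L W A z κ + Qbar L W B z κ := by
  funext z κ
  have hW := fun r => norm_Wcx_sub_one_le_32 hL hWu ha hsmall hWa ((L : ℤ) • z) κ r
  have hAB : (fun y μ => A y μ + B y μ) = A + B := rfl
  have hpush : pushDir L W (fun y μ => A y μ + B y μ) ((L : ℤ) • z) κ
      = pushDir L W A ((L : ℤ) • z) κ + pushDir L W B ((L : ℤ) • z) κ := by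
    rw [hAB, pushDir_add L W A B _ κ hW]
  simp only [Qbar, dbarLin, hpush, frameLin_add, Ad, Matrix.mul_add, Matrix.add_mul]
  abel

/-! ## §2 Gauge directions are mapped to gauge directions, at every coarse site -/

/-- **ONE LEVEL (K1 at every coarse site)**: for a unitary `(L·M)`-periodic small-field `W` and a skew `(L·M)`-periodic generator
`λ`, `cpush L W (gaugeDir W λ) = gaugeDir (cavg L W) (λ ∘ L•)` — the tree's `pushDir_gaugeDir_eq_gaugeDir_cavg` at the torus
representatives, extended to all coarse sites by `M`-periodicity of both sides. [cite: Balaban1985Averaging, (45) p.24] -/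
theorem cpush_gaugeDir [Nonempty n] {L M : ℕ} [NeZero M] [NeZero (L * M)] (hL : 1 ≤ L) {W : Site d → Fin d → 𝕄ˣ}
    (hWu : IsUnitaryCfg W) (hWP : IsPeriodicCfg W ((L * M : ℕ) : ℤ)) {a : ℝ} (ha : 0 ≤ a)
    (hsmall : 512 * (d + 1) * (d + 4) * (L : ℝ) ^ 2 * a ≤ 1) (hWa : SmallField W a)
    {lam : Site d → 𝕄} (hlam : ∀ x, lam x ∈ skewAdjoint 𝕄)
    (hlamP : ∀ (x : Site d) (i : Fin d), lam (x + ((L * M : ℕ) : ℤ) • e i) = lam x) :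
    cpush L W (gaugeDir W lam) = gaugeDir (cavg L W) (fun y => lam ((L : ℤ) • y)) := by
  have hcast : ((L * M : ℕ) : ℤ) = (L : ℤ) * (M : ℕ) := by push_cast; ring
  have hWP' : IsPeriodicCfg W ((L : ℤ) * (M : ℕ)) := by rw [← hcast]; exact hWP
  have hgP : IsPeriodicDir (gaugeDir W lam) ((L : ℤ) * (M : ℕ)) := by
    have h := isPeriodicDir_gaugeDir hWP hlamP
    rw [hcast] at h; exact h
  have h1 : IsPeriodicDir (cpush L W (gaugeDir W lam)) ((M : ℕ) : ℤ) := isPeriodicDir_cpush L M hWP' hgP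
  have hlamLP : ∀ (y : Site d) (i : Fin d),
      (fun y => lam ((L : ℤ) • y)) (y + ((M : ℕ) : ℤ) • e i) = (fun y => lam ((L : ℤ) • y)) y := by
    intro y i
    simp only [smul_add, smul_smul]
    rw [← hcast]; exact hlamP _ i
  have h2 : IsPeriodicDir (gaugeDir (cavg L W) (fun y => lam ((L : ℤ) • y))) ((M : ℕ) : ℤ) :=
    isPeriodicDir_gaugeDir (isPeriodicCfg_cavg L M hWP') hlamLP
  funext z κ
  have hz := eq_wrap_add M z
  rw [hz, periodic_smul_vec (f := fun x => cpush L W (gaugeDir W lam) x κ) (fun x i => h1 x i κ) (boxVec M (redN M z)) _,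
    periodic_smul_vec (f := fun x => gaugeDir (cavg L W) (fun y => lam ((L : ℤ) • y)) x κ) (fun x i => h2 x i κ)
      (boxVec M (redN M z)) _]
  exact pushDir_gaugeDir_eq_gaugeDir_cavg hL hWu hWP ha hsmall hWa hlam hlamP (redN M z) κ

/-! ## §3 The coarse readings are skew and periodic -/

/-- The linearised frame of a skew direction at a unitary background is skew. [folklore] -/
theorem frameLin_mem_skewAdjoint (L : ℕ) {W : Site d → Fin d → 𝕄ˣ} (hWu : IsUnitaryCfg W) {Y : Site d → Fin d → 𝕄}
    (hY : IsSkewDir Y) (y : Site d) : frameLin L W Y y ∈ skewAdjoint 𝕄 := by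
  unfold frameLin
  refine (skewAdjoint 𝕄).sum_mem fun r _ => ?_
  exact skewAdjoint.smul_mem _ (dhol_mem_skewAdjoint hWu hY y (treeWord (boxVec L r)))

/-- `Fbar` of a skew direction is a skew generator. [folklore] -/
theorem Fbar_skew (L : ℕ) {W : Site d → Fin d → 𝕄ˣ} (hWu : IsUnitaryCfg W) {Y : Site d → Fin d → 𝕄} (hY : IsSkewDir Y)
    (z : Site d) : Fbar L W Y z ∈ skewAdjoint 𝕄 :=
  frameLin_mem_skewAdjoint L hWu hY _

/-- `Qbar` of a skew direction at a unitary small-field background is skew. [folklore] -/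
theorem Qbar_skew [Nonempty n] {L : ℕ} (hL : 1 ≤ L) {W : Site d → Fin d → 𝕄ˣ} (hWu : IsUnitaryCfg W)
    {a : ℝ} (ha : 0 ≤ a) (hsmall : 512 * (d + 1) * (d + 4) * (L : ℝ) ^ 2 * a ≤ 1) (hWa : SmallField W a)
    {Y : Site d → Fin d → 𝕄} (hY : IsSkewDir Y) : IsSkewDir (Qbar L W Y) := by
  letI : CStarAlgebra 𝕄 := {}
  intro z κ
  have hW : ∀ r : Fin d → Fin L, ‖((Wcx L W ((L : ℤ) • z) κ (boxVec L r) : 𝕄ˣ) : 𝕄) - 1‖ < 1 / 4 := fun r =>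
    (norm_Wcx_sub_one_le_32 hL hWu ha hsmall hWa _ κ r).trans_lt (by norm_num)
  have hp : pushDir L W Y ((L : ℤ) • z) κ ∈ skewAdjoint 𝕄 := pushDir_mem_skewAdjoint L hWu hY _ κ hW
  have hb : bavg L W ((L : ℤ) • z) κ ∈ unitaryUnits 𝕄 :=
    bavg_mem_unitaryUnits hWu L _ κ fun r => (hW r).le
  have hf1 : Ad (bavg L W ((L : ℤ) • z) κ)⁻¹ (frameLin L W Y ((L : ℤ) • z)) ∈ skewAdjoint 𝕄 :=
    Ad_mem_skewAdjoint ((unitaryUnits 𝕄).inv_mem hb) (frameLin_mem_skewAdjoint L hWu hY _)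
  have hf2 := frameLin_mem_skewAdjoint L hWu hY ((L : ℤ) • z + (L : ℤ) • e κ)
  show dbarLin L W Y ((L : ℤ) • z) κ ∈ skewAdjoint 𝕄
  unfold dbarLin
  exact (skewAdjoint 𝕄).sub_mem hp ((skewAdjoint 𝕄).sub_mem hf1 hf2)

/-- Periodicity of the linearised frame: for `W`, `Y` with period vector `t`, `frameLin L W Y (y + t) = frameLin L W Y y`. [folklore] -/
theorem frameLin_add_period (L : ℕ) {W : Site d → Fin d → 𝕄ˣ} {Y : Site d → Fin d → 𝕄} {t : Site d}
    (hW : ∀ (x : Site d) (μ : Fin d), W (x + t) μ = W x μ) (hY : ∀ (x : Site d) (μ : Fin d), Y (x + t) μ = Y x μ) (y : Site d) :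
    frameLin L W Y (y + t) = frameLin L W Y y := by
  have hshift : shiftDir t Y = Y := by
    funext x μ
    have := hY (x - t) μ
    rw [sub_add_cancel] at this
    simpa [shiftDir] using this.symm
  unfold frameLin
  refine Finset.sum_congr rfl fun r _ => ?_
  congr 1
  have h := dhol_shift hW Y (treeWord (boxVec L r)) y
  rw [hshift] at h
  exact h

/-- Periodicity of `Fbar`: `(L·P)`-periodic data give a `P`-periodic coarse frame. [folklore] -/
theorem Fbar_add_period (L : ℕ) {W : Site d → Fin d → 𝕄ˣ} {Y : Site d → Fin d → 𝕄} {P : ℤ}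
    (hW : IsPeriodicCfg W ((L : ℤ) * P)) (hY : IsPeriodicDir Y ((L : ℤ) * P)) (z : Site d) (i : Fin d) :
    Fbar L W Y (z + P • e i) = Fbar L W Y z := by
  simp only [Fbar, smul_add, smul_smul]
  exact frameLin_add_period L (fun x μ => hW x i μ) (fun x μ => hY x i μ) _

/-- Periodicity of `pushDir` under a common period of `W` and `Y`. [folklore] -/
theorem pushDir_add_period (L : ℕ) {W : Site d → Fin d → 𝕄ˣ} {Y : Site d → Fin d → 𝕄} {t : Site d}
    (hW : ∀ (x : Site d) (μ : Fin d), W (x + t) μ = W x μ) (hY : ∀ (x : Site d) (μ : Fin d), Y (x + t) μ = Y x μ)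
    (q : Site d) (κ : Fin d) : pushDir L W Y (q + t) κ = pushDir L W Y q κ := by
  have hshift : shiftDir t Y = Y := by
    funext x μ
    have := hY (x - t) μ
    rw [sub_add_cancel] at this
    simpa [shiftDir] using this.symm
  have h := pushDir_shift L hW Y q κ
  rw [hshift] at h
  exact h

/-- Periodicity of `Qbar`: `(L·P)`-periodic data give a `P`-periodic coarse double-bar average. [folklore] -/
theorem Qbar_add_period (L : ℕ) {W : Site d → Fin d → 𝕄ˣ} {Y : Site d → Fin d → 𝕄} {P : ℤ}
    (hW : IsPeriodicCfg W ((L : ℤ) * P)) (hY : IsPeriodicDir Y ((L : ℤ) * P)) (z : Site d) (i κ : Fin d) :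
    Qbar L W Y (z + P • e i) κ = Qbar L W Y z κ := by
  have hWt : ∀ (x : Site d) (μ : Fin d), W (x + ((L : ℤ) * P) • e i) μ = W x μ := fun x μ => hW x i μ
  have hYt : ∀ (x : Site d) (μ : Fin d), Y (x + ((L : ℤ) * P) • e i) μ = Y x μ := fun x μ => hY x i μ
  have e1 : (L : ℤ) • (z + P • e i) = (L : ℤ) • z + ((L : ℤ) * P) • e i := by rw [smul_add, smul_smul]
  have e2 : (L : ℤ) • z + ((L : ℤ) * P) • e i + (L : ℤ) • e κ = (L : ℤ) • z + (L : ℤ) • e κ + ((L : ℤ) * P) • e i := by abel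
  simp only [Qbar, dbarLin, e1]
  rw [pushDir_add_period L hWt hYt, bavg_shift L hWt, frameLin_add_period L hWt hYt, e2, frameLin_add_period L hWt hYt]

end

end Summit.QuantumFields.BalabanUV.T4Continuum.NE3TangentCovariantStructure
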